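import Summits.Ventures.HodgeRepro2.Reflex
import Summits.Ventures.HodgeRepro2.BridgeCore

/-!
# The reflex field as the field of type traces (Shimura 1998 Proposition 28), via Dedekind

Blind cell `pub-hodge-repro2`, seat p1 (Tier 4, sub-claim B4 «orientation / sign convention»).

Shimura 1998, *Abelian Varieties with Complex Multiplication and Modular Functions*, §8.3,
PROPOSITION 28 (SOURCES S13.4, chunk p0082 ll. 5–15): for a CM-type `(F; {φ_i})` with Galois
closure `L`, `G = Gal(L/ℚ)`, `S = {σ ∈ G : σ|_F ∈ {φ_i}}`, `S* = {σ⁻¹ : σ ∈ S}`,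
`H* = {γ ∈ G : γS* = S*}`, the reflex field is «the subfield of L corresponding to H*» and
`K* = ℚ(Σ_i ξ^{φ_i} | ξ ∈ F)`.  Its proof (chunk p0083 ll. 1–5) shows that `γ` fixes every
trace `Σ_i ξ^{φ_i}` iff `{φ_i γ} = {φ_i}` as a whole, the «conversely» direction resting on
«an elementary theorem of algebra» (equal power sums ⇒ equal multisets).

This file proves both directions in Lean **without** power sums, from Dedekind's theorem on
the linear independence of distinct characters (`BridgeCore.linearIndependent_ringHom`, p4's
file, itself Mathlib's `linearIndependent_monoidHom`):

* `finset_eq_of_forall_sum_eq` — two finite sets of ring homomorphisms `K →+* L` with the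
  same trace function `ξ ↦ Σ_{φ ∈ Φ} φ ξ` are equal.
* `image_comp_eq_of_forall_map_typeTrace_eq` — a ring homomorphism `h : L →+* L` fixing every
  trace of `Φ` satisfies `h ∘ Φ = Φ` (post-composition); this is the statement needed, for
  `L = ℂ` and `h ∈ Aut(ℂ)`, to know that the set `Φ̃(τ′) = {θ : g_θ⁻¹ ∘ τ′ ∈ Φ_μ}` of
  TIER4 §B3(e) is well defined (an automorphism fixing the reflex field `M_μ` pointwise
  stabilises `Φ_μ`).  The converse `forall_map_typeTrace_eq_of_image_comp_eq` is the easy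
  direction.
* In the Galois-group picture of `Reflex.lean` (`K/ℚ` Galois, `G = Gal(K/ℚ)`,
  `S ⊂ G` a finite set): `traceField S := ℚ(Σ_{σ ∈ S} σ ξ | ξ ∈ K)` has fixing subgroup
  exactly `typeStabilizer S = {γ : γ • S = S}` (`fixingSubgroup_traceField`), hence by the
  Galois correspondence `traceField S = fixedField (typeStabilizer S)`
  (`traceField_eq_fixedField_typeStabilizer`) — Proposition 28 for a Galois CM field, both
  directions, for **every** finite Galois group.

CONVENTION NOTE (p1, gen 3; corrects the wording of LEAN-ANNEX-p1.md §9.7).  Lean composes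
automorphisms as functions, `(γ * σ) x = γ (σ x)` (`AlgEquiv.mul_apply`), whereas Shimura writes
`ξ^{στ} = (ξ^σ)^τ`, so Shimura's product `στ` is the function `τ ∘ σ`.  Consequently Shimura's
`H* = {γ : γS* = S*}` — equivalently `{γ : Sγ = S}` (proof of Prop. 28, p0083 l. 1) — is the
post-composition stabiliser `{γ : γ ∘ S = S}`, which is `typeStabilizer S = {γ : γ • S = S}`
in `Reflex.lean`; and Shimura's `H' = {γ : γS = S}` of Prop. 26 / §8.4 Ex. (1) is the
pre-composition stabiliser `{γ : S ∘ γ = S} = typeStabilizer S⁻¹`, which `Reflex.lean` named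
`reflexStabilizer`.  For an ABELIAN Galois group (the cell's sextic case,
`GaloisSextic.isMulCommutative_gal_of_finrank_six`) the two coincide
(`typeStabilizer_inv_eq_of_comm`), so every degree-6 theorem of `Reflex.lean` is unaffected;
for a non-abelian `G` the field `reflexFieldOf` of `Reflex.lean` is the fixed field of `H'`
(the largest subfield from which the type is induced), while the reflex field proper is
`traceField S = fixedField (typeStabilizer S)` of this file.
-/

namespace Summit.Ventures.HodgeRepro2

open scoped BigOperators Classical

section Dedekind

variable {K L : Type*} [Field K] [Field L]

/-- Two finite sets of ring homomorphisms `K →+* L` with the same trace function are equal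
(Dedekind's theorem: distinct characters are linearly independent). -/
theorem finset_eq_of_forall_sum_eq (Φ Φ' : Finset (K →+* L))
    (h : ∀ ξ : K, ∑ φ ∈ Φ, φ ξ = ∑ φ ∈ Φ', φ ξ) : Φ = Φ' := by
  classical
  have hli : LinearIndependent L fun φ : K →+* L => ⇑(φ : K →* L) :=
    BridgeCore.linearIndependent_ringHom (fun φ : K →+* L => φ) fun _ _ e => e
  rw [linearIndependent_iff'] at hli
  set g : (K →+* L) → L := fun φ => (if φ ∈ Φ then (1 : L) else 0) - (if φ ∈ Φ' then 1 else 0)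
    with hg
  have key : ∀ φ ∈ Φ ∪ Φ', g φ = 0 := by
    refine hli (Φ ∪ Φ') g ?_
    funext ξ
    have h1 : ∑ φ ∈ Φ ∪ Φ', (if φ ∈ Φ then φ ξ else 0) = ∑ φ ∈ Φ, φ ξ := by
      rw [Finset.sum_ite_mem, Finset.union_inter_cancel_left]
    have h2 : ∑ φ ∈ Φ ∪ Φ', (if φ ∈ Φ' then φ ξ else 0) = ∑ φ ∈ Φ', φ ξ := by
      rw [Finset.sum_ite_mem, Finset.union_inter_cancel_right]
    simp only [Finset.sum_apply, Pi.smul_apply, smul_eq_mul, Pi.zero_apply, hg, sub_mul, ite_mul,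
      one_mul, zero_mul, Finset.sum_sub_distrib]
    rw [show (∑ φ ∈ Φ ∪ Φ', (if φ ∈ Φ then (φ : K →* L) ξ else 0)) = ∑ φ ∈ Φ, φ ξ from h1,
      show (∑ φ ∈ Φ ∪ Φ', (if φ ∈ Φ' then (φ : K →* L) ξ else 0)) = ∑ φ ∈ Φ', φ ξ from h2, h ξ,
      sub_self]
  ext φ
  constructor
  · intro hφ
    have := key φ (Finset.mem_union_left _ hφ)
    simp only [hg, hφ, if_true] at this
    by_contra hφ'
    simp [hφ'] at this
  · intro hφ'
    have := key φ (Finset.mem_union_right _ hφ')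
    simp only [hg, hφ', if_true] at this
    by_contra hφ
    simp [hφ] at this

/-- The trace function of a finite set of embeddings: `ξ ↦ Σ_{φ ∈ Φ} φ ξ`
(Shimura's `Σ_i ξ^{φ_i}`). -/
def typeTrace (Φ : Finset (K →+* L)) (ξ : K) : L := ∑ φ ∈ Φ, φ ξ

/-- Unfolding lemma for `typeTrace`. -/
theorem typeTrace_def (Φ : Finset (K →+* L)) (ξ : K) : typeTrace Φ ξ = ∑ φ ∈ Φ, φ ξ := rfl

/-- Finite sets of embeddings with the same trace function are equal. -/
theorem eq_of_forall_typeTrace_eq (Φ Φ' : Finset (K →+* L))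
    (h : ∀ ξ, typeTrace Φ ξ = typeTrace Φ' ξ) : Φ = Φ' :=
  finset_eq_of_forall_sum_eq Φ Φ' h

variable {L' : Type*} [Field L']

/-- Post-composition `φ ↦ h ∘ φ` is injective on embeddings (a ring homomorphism out of a
field is injective). -/
theorem comp_injective (h : L →+* L') : Function.Injective fun φ : K →+* L => h.comp φ := by
  intro φ ψ e
  ext x
  have := congrArg (fun f : K →+* L' => f x) e
  exact h.injective (by simpa using this)

/-- The trace of the post-composed set `h ∘ Φ` is `h` applied to the trace of `Φ`. -/
theorem typeTrace_image_comp (h : L →+* L') (Φ : Finset (K →+* L)) (ξ : K) :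
    typeTrace (Φ.image fun φ => h.comp φ) ξ = h (typeTrace Φ ξ) := by
  classical
  unfold typeTrace
  rw [Finset.sum_image (fun φ _ ψ _ e => comp_injective h e), map_sum]
  rfl

/-- **The hard direction of Shimura 1998 Prop. 28** (without power sums): a ring homomorphism
`h : L →+* L` fixing every trace `Σ_{φ ∈ Φ} φ ξ` satisfies `h ∘ Φ = Φ`.
With `L = ℂ`: an automorphism of `ℂ` fixing the reflex field `ℚ(traces of Φ)` pointwise
stabilises the CM type `Φ` under post-composition. -/
theorem image_comp_eq_of_forall_map_typeTrace_eq (h : L →+* L) (Φ : Finset (K →+* L))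
    (hfix : ∀ ξ, h (typeTrace Φ ξ) = typeTrace Φ ξ) :
    (Φ.image fun φ => h.comp φ) = Φ :=
  eq_of_forall_typeTrace_eq _ _ fun ξ => by rw [typeTrace_image_comp, hfix]

/-- The easy direction: if `h ∘ Φ = Φ` then `h` fixes every trace of `Φ`. -/
theorem forall_map_typeTrace_eq_of_image_comp_eq (h : L →+* L) (Φ : Finset (K →+* L))
    (hΦ : (Φ.image fun φ => h.comp φ) = Φ) (ξ : K) : h (typeTrace Φ ξ) = typeTrace Φ ξ := by
  rw [← typeTrace_image_comp, hΦ]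

/-- Both directions in one statement. -/
theorem image_comp_eq_iff_forall_map_typeTrace_eq (h : L →+* L) (Φ : Finset (K →+* L)) :
    (Φ.image fun φ => h.comp φ) = Φ ↔ ∀ ξ, h (typeTrace Φ ξ) = typeTrace Φ ξ :=
  ⟨forall_map_typeTrace_eq_of_image_comp_eq h Φ, image_comp_eq_of_forall_map_typeTrace_eq h Φ⟩

end Dedekind

section GaloisGroup

variable (K : Type*) [Field K] [NumberField K]

/-- The internal trace of a finite set `S ⊂ Gal(K/ℚ)`: `ξ ↦ Σ_{σ ∈ S} σ ξ ∈ K`.  Through a base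
embedding `τ₀ : K →+* ℂ` it is the type trace of `Φ = {τ₀ ∘ σ : σ ∈ S}` (see
`typeTrace_image_galEmb`). -/
def internalTrace (S : Finset Gal(K/ℚ)) (ξ : K) : K := ∑ σ ∈ S, σ ξ

variable {K}

/-- Unfolding lemma for `internalTrace`. -/
theorem internalTrace_def (S : Finset Gal(K/ℚ)) (ξ : K) : internalTrace K S ξ = ∑ σ ∈ S, σ ξ :=
  rfl

/-- Left translation by `γ` is injective. -/
theorem mul_left_injective' (γ : Gal(K/ℚ)) : Function.Injective fun σ : Gal(K/ℚ) => γ * σ :=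
  mul_right_injective γ

/-- `γ` applied to the trace of `S` is the trace of `γ • S = {γ * σ}` (post-composition). -/
theorem map_internalTrace (γ : Gal(K/ℚ)) (S : Finset Gal(K/ℚ)) (ξ : K) :
    γ (internalTrace K S ξ) = internalTrace K (S.image fun σ => γ * σ) ξ := by
  classical
  unfold internalTrace
  rw [Finset.sum_image (fun σ _ ψ _ e => mul_left_injective' γ e), map_sum]
  simp only [AlgEquiv.mul_apply]

/-- Elements of `Gal(K/ℚ)` are determined by their underlying ring homomorphisms. -/
theorem galRingHom_injective :
    Function.Injective fun σ : Gal(K/ℚ) => (σ : K →+* K) := by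
  intro σ τ e
  ext x
  exact congrArg (fun f : K →+* K => f x) e

/-- Dedekind in the Galois group: finite subsets of `Gal(K/ℚ)` with the same internal trace
function are equal. -/
theorem finset_eq_of_forall_internalTrace_eq (S S' : Finset Gal(K/ℚ))
    (h : ∀ ξ, internalTrace K S ξ = internalTrace K S' ξ) : S = S' := by
  classical
  have e := finset_eq_of_forall_sum_eq (S.image fun σ : Gal(K/ℚ) => (σ : K →+* K))
    (S'.image fun σ : Gal(K/ℚ) => (σ : K →+* K)) (fun ξ => by
      rw [Finset.sum_image (fun σ _ ψ _ e => galRingHom_injective e),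
        Finset.sum_image (fun σ _ ψ _ e => galRingHom_injective e)]
      exact h ξ)
  exact Finset.image_injective galRingHom_injective e

/-- **Prop. 28, hard direction, internal form**: if `γ` fixes every internal trace of `S`, then
`γ • S = S`, i.e. `γ ∈ typeStabilizer S` (= Shimura's `H*`, see the convention note). -/
theorem image_mul_eq_of_forall_map_internalTrace_eq (γ : Gal(K/ℚ)) (S : Finset Gal(K/ℚ))
    (hfix : ∀ ξ, γ (internalTrace K S ξ) = internalTrace K S ξ) :
    (S.image fun σ => γ * σ) = S :=
  finset_eq_of_forall_internalTrace_eq _ _ fun ξ => by rw [← map_internalTrace, hfix]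

/-- The easy direction in the Galois group: `γ • S = S` ⇒ `γ` fixes every internal trace of `S`. -/
theorem forall_map_internalTrace_eq_of_image_mul_eq (γ : Gal(K/ℚ)) (S : Finset Gal(K/ℚ))
    (hS : (S.image fun σ => γ * σ) = S) (ξ : K) :
    γ (internalTrace K S ξ) = internalTrace K S ξ := by
  rw [map_internalTrace, hS]

/-- `γ • (S : Set G) = S` (the `typeStabilizer` condition of `Reflex.lean`) is the finset
statement `S.image (γ * ·) = S`. -/
theorem mem_typeStabilizer_iff_image_mul_eq (γ : Gal(K/ℚ)) (S : Finset Gal(K/ℚ)) :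
    γ ∈ typeStabilizer (S : Set Gal(K/ℚ)) ↔ (S.image fun σ => γ * σ) = S := by
  classical
  rw [mem_typeStabilizer_iff, ← Finset.coe_inj, Finset.coe_image]
  rfl

/-- `γ` lies in the post-composition stabiliser of `S` iff it fixes every internal trace of
`S` — Shimura 1998 Prop. 28, proof, both directions. -/
theorem mem_typeStabilizer_iff_forall_map_internalTrace_eq (γ : Gal(K/ℚ))
    (S : Finset Gal(K/ℚ)) :
    γ ∈ typeStabilizer (S : Set Gal(K/ℚ)) ↔ ∀ ξ, γ (internalTrace K S ξ) = internalTrace K S ξ := by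
  rw [mem_typeStabilizer_iff_image_mul_eq]
  exact ⟨forall_map_internalTrace_eq_of_image_mul_eq γ S,
    image_mul_eq_of_forall_map_internalTrace_eq γ S⟩

variable (K) in
/-- **Shimura's reflex field** `K* = ℚ(Σ_{σ ∈ S} σ ξ | ξ ∈ K)` (Prop. 28), as an intermediate
field of `K/ℚ`, for the CM type `{τ₀ ∘ σ : σ ∈ S}` in the Galois-group picture. -/
def traceField (S : Finset Gal(K/ℚ)) : IntermediateField ℚ K :=
  IntermediateField.adjoin ℚ (Set.range (internalTrace K S))

/-- The generators of the trace field lie in it. -/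
theorem internalTrace_mem_traceField (S : Finset Gal(K/ℚ)) (ξ : K) :
    internalTrace K S ξ ∈ traceField K S :=
  IntermediateField.subset_adjoin ℚ _ ⟨ξ, rfl⟩

/-- The fixing subgroup of the trace field is exactly the post-composition stabiliser
`typeStabilizer S` (Shimura's `H*`): Prop. 28 in the form «`K*` is the subfield of `L`
corresponding to `H*`», both inclusions. -/
theorem fixingSubgroup_traceField (S : Finset Gal(K/ℚ)) :
    (traceField K S).fixingSubgroup = typeStabilizer (S : Set Gal(K/ℚ)) := by
  ext γ
  rw [mem_typeStabilizer_iff_forall_map_internalTrace_eq, IntermediateField.mem_fixingSubgroup_iff]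
  constructor
  · intro h ξ
    exact h _ (internalTrace_mem_traceField S ξ)
  · intro h x hx
    -- every generator is fixed by `γ`, hence so is the field they generate
    have hle : traceField K S ≤ IntermediateField.fixedField (Subgroup.zpowers γ) := by
      refine IntermediateField.adjoin_le_iff.2 ?_
      rintro _ ⟨ξ, rfl⟩
      rw [SetLike.mem_coe, IntermediateField.mem_fixedField_iff]
      intro f hf
      obtain ⟨n, rfl⟩ := Subgroup.mem_zpowers_iff.1 hf
      refine zpow_induction_left (P := fun g : Gal(K/ℚ) => g (internalTrace K S ξ) = internalTrace K S ξ)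
        ?_ ?_ ?_ n
      · simp
      · intro g hg
        rw [AlgEquiv.mul_apply, hg, h]
      · intro g hg
        rw [AlgEquiv.mul_apply, hg]
        conv_lhs => rw [← h ξ]
        rw [← AlgEquiv.mul_apply, inv_mul_cancel, AlgEquiv.one_apply]
    have := hle hx
    rw [IntermediateField.mem_fixedField_iff] at this
    exact this γ (Subgroup.mem_zpowers γ)

variable [IsGalois ℚ K]

/-- **Shimura 1998, Proposition 28, for a Galois CM field**: the field generated by the type
traces is the fixed field of the post-composition stabiliser `H* = typeStabilizer S`, for
every finite Galois group `Gal(K/ℚ)` (no abelian hypothesis). -/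
theorem traceField_eq_fixedField_typeStabilizer (S : Finset Gal(K/ℚ)) :
    traceField K S = IntermediateField.fixedField (typeStabilizer (S : Set Gal(K/ℚ))) := by
  rw [← fixingSubgroup_traceField, IsGalois.fixedField_fixingSubgroup]

/-- `[K : K*] = |H*|` (Prop. 28 / Galois correspondence). -/
theorem finrank_traceField (S : Finset Gal(K/ℚ)) :
    Module.finrank (traceField K S) K = Nat.card (typeStabilizer (S : Set Gal(K/ℚ))) := by
  rw [traceField_eq_fixedField_typeStabilizer, IntermediateField.finrank_fixedField_eq_card]

/-- If the post-composition stabiliser is trivial (`IsPrimitiveOn` of `Faces.lean`), the reflex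
field is `K` itself — Shimura §8.4 Example (1) «the field corresponding to H* is F». -/
theorem traceField_eq_top_of_isPrimitiveOn (S : Finset Gal(K/ℚ))
    (h : IsPrimitiveOn (S : Set Gal(K/ℚ))) : traceField K S = ⊤ := by
  rw [traceField_eq_fixedField_typeStabilizer, (isPrimitiveOn_iff_typeStabilizer_eq_bot _).1 h,
    IntermediateField.fixedField_bot]

/-- For an abelian Galois group, `traceField S` is the `reflexFieldOf` of `Reflex.lean`
(`reflexStabilizer = typeStabilizer S⁻¹ = typeStabilizer S`), so the two definitions of the
reflex field agree in the cell's sextic case. -/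
theorem traceField_eq_reflexFieldOf [IsMulCommutative Gal(K/ℚ)] (τ₀ : K →+* ℂ)
    (S : Finset Gal(K/ℚ)) :
    traceField K S = reflexFieldOf K τ₀ ((galEmb K τ₀) '' (S : Set Gal(K/ℚ))) := by
  rw [traceField_eq_fixedField_typeStabilizer]
  unfold reflexFieldOf
  congr 1
  rw [reflexStabilizer_eq_of_comm]
  congr 1
  rw [Set.preimage_image_eq _ (galEmb K τ₀).injective]

/-- Through the base embedding `τ₀`, the internal trace of `S` is the complex type trace of the
CM type `Φ = galEmb τ₀ '' S = {τ₀ ∘ σ : σ ∈ S}`: `Σ_{φ ∈ Φ} φ ξ = τ₀ (Σ_{σ ∈ S} σ ξ)`.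
Hence Shimura's `K* ⊂ ℂ` is `τ₀ (traceField S)`. -/
theorem typeTrace_image_galEmb (τ₀ : K →+* ℂ) (S : Finset Gal(K/ℚ)) (ξ : K) :
    typeTrace (S.image (galEmb K τ₀)) ξ = τ₀ (internalTrace K S ξ) := by
  classical
  unfold typeTrace internalTrace
  rw [Finset.sum_image (fun σ _ ψ _ e => (galEmb K τ₀).injective e), map_sum]
  rfl

end GaloisGroup

end Summit.Ventures.HodgeRepro2
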